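import Literature.Analysis.FluidPDE.TorusClassicalNSH4Smoothing
import Literature.Analysis.FluidPDE.TorusClassicalNSH3Smoothing
import Literature.Analysis.FunctionSpaces.TorusClassicalNSUniqueness
import HarnessLib

/-!
# The `H⁴` level of classical Navier–Stokes solutions on `T³` after a time lapse, from the enstrophy level

Analysis/FluidPDE proof file (theorems only; no definitions, no named facts), the CHAINING of the
quantitative parabolic smoothing estimates `TorusClassicalNSH2Smoothing` (`‖Δu(a+τ)‖₂² ≤ C₂` from a sup
bound of the enstrophy on `[a, a+τ]`), `TorusClassicalNSH3Smoothing` (`‖∇Δu(a+τ)‖₂² ≤ C₃` and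
`‖∂ₖu(a+τ)‖_∞ ≤ M₁` from sup bounds of `‖∇u‖₂²`, `‖Δu‖₂²`), the sup-norm embedding
`Torus.norm_sq_le_gradNormSq_add_of_hasZeroMean` (`‖u‖_∞² ≤ K(‖∇u‖₂² + ‖Δu‖₂²)` for mean-zero fields on
`T³`) and `TorusClassicalNSH4Smoothing` (`‖Δ²u(a+τ)‖₂² ≤ C₄` from sup bounds of `‖∇u‖₂²`, `‖Δu‖₂²`,
`‖∇Δu‖₂²`, `‖u‖_∞`, `‖∂ₖu‖_∞`) into the single statement consumed by continuation arguments
(Robinson–Rodrigo–Sadowski 2016, Thm 7.5 with Thm 7.1: a strong solution is smooth for `t > 0`, with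
`H^k` bounds at time `t` depending only on the enstrophy level, the force and the lapse `t`):

* `Torus.IsClassicalNSSolutionOn.integral_norm_laplacian_laplacian_sq_le_of_gradNormSq_le` — on `T^d`,
  `card d = 3`, for `ν > 0`, an enstrophy level `E`, force levels `G, G₂, G₃` (of `‖∇f‖₂²`, `‖Δf‖₂²`,
  `‖∇Δf‖₂²`) and a lapse `τ > 0` there is `C` such that every classical solution `(u, p)` of NS_ν(f) on
  `[a, b] × T^d` with zero-mean velocity slices and `‖∇u(t)‖₂² ≤ E` on `[a, b]` has
  `∫ ‖Δ²u(t)‖² ≤ C` at every `t ∈ [a + 3τ, b]` (three windows of length `τ`: `H²` from `a + τ` on,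
  `H³`/`W^{1,∞}`/`L^∞` from `a + 2τ` on, `H⁴` from `a + 3τ` on);
* `Torus.sum_one_add_freqNormSq_pow_four_mul_sq_norm_mFourierCoeff_sub_le` — the restart level of a
  difference: for smooth mean-zero `u, w` with `∫ ‖Δ²u‖² ≤ C`, `∫ ‖Δ²w‖² ≤ D`, the fourth Sobolev sums of
  `u − w` are `≤ 2C + 2D` (Parseval, `Torus.sum_one_add_freqNormSq_pow_four_mul_sq_norm_mFourierCoeff_le`);
* `Torus.IsSmoothSpaceTimeOn.exists_integral_norm_laplacian_laplacian_sq_le` — a jointly smooth field on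
  a compact window has `∫ ‖Δ²u(t)‖²` bounded there.

## Mathlib / tree search

Tree (reused): the four smoothing theorems above, `Torus.IsClassicalNSSolutionOn.mono`
(`TorusClassicalNSGluing`), `Torus.laplacian_sub` (`TorusClassicalNSUniqueness`),
`Torus.IsSmoothSpaceTimeOn.exists_norm_le_of_isCompact` (`TorusSpaceTime`).
Searched `laplacian_laplacian_sq_le_of_gradNormSq`, `3 * τ`, `sobolevFourSum.*sub`: no chained statement.

## References

* J. C. Robinson, J. L. Rodrigo, W. Sadowski, *The Three-Dimensional Navier–Stokes Equations*,
  CUP 2016, Thm 7.1, Thm 7.5. [RobinsonRodrigoSadowskiCUP2016]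
* P. Constantin, C. Foias, *Navier–Stokes Equations*, Univ. Chicago Press 1988, Ch. 10, Thm 10.6.
  [ConstantinFoiasNSE1988]
-/

noncomputable section

open MeasureTheory Set Function Filter UnitAddTorus
open scoped ContDiff InnerProductSpace RealInnerProductSpace Topology NNReal

namespace Literature.Analysis.FluidPDE

open Literature.Analysis.FunctionSpaces

variable {d : Type*} [Fintype d] [DecidableEq d]

/-! ### Windows inside a solution interval -/

/-- Restriction of a classical solution on `[a, b]` to the window `[s − τ, s]` of length `τ > 0`
ending at a time `s ∈ [a + τ, b]`, written as `[s − τ, (s − τ) + τ]` (the shape of the smoothing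
theorems). [folklore] -/
theorem _root_.Literature.Analysis.FunctionSpaces.Torus.IsClassicalNSSolutionOn.mono_window
    {a b ν τ : ℝ} {f u : ℝ → UnitAddTorus d → EuclideanSpace ℝ d} {p : ℝ → UnitAddTorus d → ℝ}
    (h : Torus.IsClassicalNSSolutionOn (Icc a b) ν f u p) (hτ : 0 < τ) {s : ℝ} (hs : s ∈ Icc a b)
    (hτs : a + τ ≤ s) :
    Torus.IsClassicalNSSolutionOn (Icc (s - τ) (s - τ + τ)) ν f u p ∧
      Icc (s - τ) (s - τ + τ) ⊆ Icc a b ∧ ∀ r ∈ Icc (s - τ) (s - τ + τ), s - τ ≤ r := by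
  have hsub : Icc (s - τ) (s - τ + τ) ⊆ Icc a b := by
    rw [sub_add_cancel]
    exact Icc_subset_Icc (by linarith) hs.2
  exact ⟨h.mono hsub (uniqueDiffOn_Icc (by linarith)), hsub, fun r hr => hr.1⟩

/-! ### The `H⁴` level after a lapse -/

/-- **The `H⁴` level of classical Navier–Stokes solutions on `T³` after a time lapse, from the
enstrophy level** (Robinson–Rodrigo–Sadowski 2016, Thm 7.5 with Thm 7.1, `k ≤ 4`; Constantin–Foias 1988,
Thm 10.6): on `T^d` with `card d = 3`, for `ν > 0`, an enstrophy level `E`, force levels `G, G₂, G₃` and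
a lapse `τ > 0` there is a constant `C` such that for EVERY classical solution `(u, p)` of the
Navier–Stokes system with force `f` on `[a, b] × T^d` whose velocity slices have zero mean, with
`‖∇u(t)‖₂² ≤ E`, `‖∇f(t)‖₂² ≤ G`, `∫ ‖Δf(t)‖² ≤ G₂`, `‖∇Δf(t)‖₂² ≤ G₃` on `[a, b]`, one has
`∫ ‖ΔΔu(t)‖² ≤ C` for all `t ∈ [a, b]` with `a + 3τ ≤ t` — uniformly in `a`, `b` and in the solution.
Proof: `H²` smoothing on the windows `[s − τ, s]`, `s ≥ a + τ`; then `H³` smoothing, the `W^{1,∞}` bound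
and the sup-norm embedding for `s ≥ a + 2τ`; then `H⁴` smoothing for `t ≥ a + 3τ`.
[cite: RobinsonRodrigoSadowskiCUP2016, Thm 7.1 and Thm 7.5] -/
theorem _root_.Literature.Analysis.FunctionSpaces.Torus.IsClassicalNSSolutionOn.integral_norm_laplacian_laplacian_sq_le_of_gradNormSq_le
    (hd : Fintype.card d = 3) {ν : ℝ} (hν : 0 < ν) (E G G₂ G₃ : ℝ) {τ : ℝ} (hτ : 0 < τ) :
    ∃ C : ℝ, ∀ {a b : ℝ} {f u : ℝ → UnitAddTorus d → EuclideanSpace ℝ d} {p : ℝ → UnitAddTorus d → ℝ},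
      Torus.IsClassicalNSSolutionOn (Icc a b) ν f u p →
      (∀ t ∈ Icc a b, Torus.HasZeroMean (u t)) →
      (∀ t ∈ Icc a b, Torus.gradNormSq (u t) ≤ E) →
      (∀ t ∈ Icc a b, Torus.gradNormSq (f t) ≤ G) →
      (∀ t ∈ Icc a b, ∫ x, ‖Torus.laplacian (f t) x‖ ^ 2 ≤ G₂) →
      (∀ t ∈ Icc a b, Torus.gradNormSq (Torus.laplacian (f t)) ≤ G₃) →
        ∀ t ∈ Icc a b, a + 3 * τ ≤ t →
          ∫ x, ‖Torus.laplacian (Torus.laplacian (u t)) x‖ ^ 2 ≤ C := by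
  -- the constants of the three smoothing steps and of the sup-norm embedding
  obtain ⟨C₂, hC₂⟩ :=
    Torus.IsClassicalNSSolutionOn.integral_norm_laplacian_sq_le_of_gradNormSq_le (d := d) hd hν E G hτ
  obtain ⟨C₃, hC₃⟩ := Torus.IsClassicalNSSolutionOn.gradNormSq_laplacian_le_of_le (d := d) hd hν E C₂ G G₂ hτ
  obtain ⟨M₁, hM₁⟩ := Torus.IsClassicalNSSolutionOn.norm_partialDeriv_le_of_le (d := d) hd hν E C₂ G G₂ hτ
  obtain ⟨K, hK, hsup⟩ := Torus.norm_sq_le_gradNormSq_add_of_hasZeroMean (d := d) hd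
  set M : ℝ := Real.sqrt (K * (E + C₂)) with hM
  obtain ⟨C₄, hC₄⟩ :=
    Torus.IsClassicalNSSolutionOn.integral_norm_laplacian_laplacian_sq_le_of_le (d := d) hd hν E C₂ C₃ G₂ G₃
      M M₁ hτ
  refine ⟨C₄, fun {a b f u p} h h0 hE hG hG₂ hG₃ t ht hτt => ?_⟩
  -- Step 1: `H²` bound at every time `s ≥ a + τ`
  have hY : ∀ s ∈ Icc a b, a + τ ≤ s → ∫ x, ‖Torus.laplacian (u s) x‖ ^ 2 ≤ C₂ := by
    intro s hs hτs
    obtain ⟨hw, hsub, -⟩ := h.mono_window hτ hs hτs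
    have h1 := hC₂ hw (fun r hr => h0 r (hsub hr)) (fun r hr => hE r (hsub hr)) (fun r hr => hG r (hsub hr))
    rwa [sub_add_cancel] at h1
  -- Step 2: `H³`, `W^{1,∞}` and sup bounds at every time `s ≥ a + 2τ`
  have hZ : ∀ s ∈ Icc a b, a + 2 * τ ≤ s → Torus.gradNormSq (Torus.laplacian (u s)) ≤ C₃ := by
    intro s hs hτs
    obtain ⟨hw, hsub, hleft⟩ := h.mono_window hτ hs (by linarith)
    have h1 := hC₃ hw (fun r hr => h0 r (hsub hr)) (fun r hr => hE r (hsub hr))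
      (fun r hr => hY r (hsub hr) (by linarith [hleft r hr])) (fun r hr => hG r (hsub hr))
      (fun r hr => hG₂ r (hsub hr))
    rwa [sub_add_cancel] at h1
  have hΛ : ∀ i, ∀ s ∈ Icc a b, a + 2 * τ ≤ s → ∀ x, ‖Torus.partialDeriv i (u s) x‖ ≤ M₁ := by
    intro i s hs hτs x
    obtain ⟨hw, hsub, hleft⟩ := h.mono_window hτ hs (by linarith)
    have h1 := hM₁ hw (fun r hr => h0 r (hsub hr)) (fun r hr => hE r (hsub hr))
      (fun r hr => hY r (hsub hr) (by linarith [hleft r hr])) (fun r hr => hG r (hsub hr))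
      (fun r hr => hG₂ r (hsub hr)) i x
    rwa [sub_add_cancel] at h1
  have hMs : ∀ s ∈ Icc a b, a + τ ≤ s → ∀ x, ‖u s x‖ ≤ M := by
    intro s hs hτs x
    have h1 := hsup (u s) (h.smooth_velocity.isSmooth_slice hs) (h0 s hs) x
    rw [hM, ← Real.sqrt_sq (norm_nonneg (u s x))]
    exact Real.sqrt_le_sqrt (h1.trans (mul_le_mul_of_nonneg_left (add_le_add (hE s hs) (hY s hs hτs)) hK.le))
  -- Step 3: `H⁴` smoothing on the window `[t − τ, t] ⊆ [a + 2τ, b]`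
  obtain ⟨hw, hsub, hleft⟩ := h.mono_window hτ ht (by linarith)
  have h1 := hC₄ hw (fun r hr => h0 r (hsub hr)) (fun r hr => hE r (hsub hr))
    (fun r hr => hY r (hsub hr) (by linarith [hleft r hr]))
    (fun r hr => hZ r (hsub hr) (by linarith [hleft r hr])) (fun r hr => hG₂ r (hsub hr))
    (fun r hr => hG₃ r (hsub hr)) (fun r hr x => hMs r (hsub hr) (by linarith [hleft r hr]) x)
    (fun i r hr x => hΛ i r (hsub hr) (by linarith [hleft r hr]) x)
  rwa [sub_add_cancel] at h1

/-! ### Restart levels -/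

omit [DecidableEq d] in
/-- `∫ ‖g − h‖² ≤ 2 ∫ ‖g‖² + 2 ∫ ‖h‖²` for smooth fields on the torus. [folklore] -/
theorem Torus.integral_norm_sub_sq_le_two_mul {F' : Type*} [NormedAddCommGroup F'] [InnerProductSpace ℝ F']
    {g h : UnitAddTorus d → F'} (hg : Torus.IsSmooth g) (hh : Torus.IsSmooth h) :
    ∫ x, ‖g x - h x‖ ^ 2 ≤ 2 * (∫ x, ‖g x‖ ^ 2) + 2 * ∫ x, ‖h x‖ ^ 2 := by
  have hpt : ∀ x, ‖g x - h x‖ ^ 2 ≤ 2 * ‖g x‖ ^ 2 + 2 * ‖h x‖ ^ 2 := fun x => by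
    have h1 : ‖g x - h x‖ ≤ ‖g x‖ + ‖h x‖ := norm_sub_le _ _
    have h2 : ‖g x - h x‖ ^ 2 ≤ (‖g x‖ + ‖h x‖) ^ 2 := pow_le_pow_left₀ (norm_nonneg _) h1 2
    nlinarith [sq_nonneg (‖g x‖ - ‖h x‖)]
  have hig : Integrable (fun x => ‖g x‖ ^ 2) := hg.norm_sq.integrable
  have hih : Integrable (fun x => ‖h x‖ ^ 2) := hh.norm_sq.integrable
  calc ∫ x, ‖g x - h x‖ ^ 2 ≤ ∫ x, (2 * ‖g x‖ ^ 2 + 2 * ‖h x‖ ^ 2) :=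
        integral_mono (hg.sub hh).norm_sq.integrable ((hig.const_mul 2).add (hih.const_mul 2)) hpt
    _ = 2 * (∫ x, ‖g x‖ ^ 2) + 2 * ∫ x, ‖h x‖ ^ 2 := by
        rw [integral_add (hig.const_mul 2) (hih.const_mul 2), integral_const_mul, integral_const_mul]

/-- **Restart level of a difference.** For smooth mean-zero fields `u, w : T^d → ℝ^d` with
`∫ ‖Δ²u‖² ≤ C` and `∫ ‖Δ²w‖² ≤ D`, every fourth Sobolev sum of `u − w` is `≤ 2C + 2D`:
`∑_{k∈S} (1 + |k|²)⁴ ‖𝓕(u − w)(k)‖² ≤ ∫ ‖Δ²(u − w)‖²`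
(`Torus.sum_one_add_freqNormSq_pow_four_mul_sq_norm_mFourierCoeff_le`, Grafakos 2014, Prop. 3.2.7 (3)) and
`Δ²(u − w) = Δ²u − Δ²w`. This is the hypothesis shape of the perturbed local existence theorem
`Torus.perturbedNS_exists_local` for the restart datum `u(s) − ū(s)`. [cite: Grafakos2014, Prop. 3.2.7 (3)] -/
theorem Torus.sum_one_add_freqNormSq_pow_four_mul_sq_norm_mFourierCoeff_sub_le
    {u w : UnitAddTorus d → EuclideanSpace ℝ d} (hu : Torus.IsSmooth u) (hw : Torus.IsSmooth w)
    (hu0 : Torus.HasZeroMean u) (hw0 : Torus.HasZeroMean w) {C D : ℝ}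
    (hC : ∫ x, ‖Torus.laplacian (Torus.laplacian u) x‖ ^ 2 ≤ C)
    (hD : ∫ x, ‖Torus.laplacian (Torus.laplacian w) x‖ ^ 2 ≤ D) (S : Finset (d → ℤ)) :
    ∑ k ∈ S, (1 + Torus.freqNormSq k) ^ 4 *
        ‖mFourierCoeff (EuclideanSpace.complexify ∘ fun y => u y - w y) k‖ ^ 2 ≤ 2 * C + 2 * D := by
  have hv : Torus.IsSmooth (fun y => u y - w y) := hu.sub hw
  have hv0 : Torus.HasZeroMean (fun y => u y - w y) := by
    unfold Torus.HasZeroMean at hu0 hw0 ⊢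
    rw [integral_sub hu.integrable hw.integrable, hu0, hw0, sub_zero]
  have h1 := Torus.sum_one_add_freqNormSq_pow_four_mul_sq_norm_mFourierCoeff_le hv hv0 S
  have hΔΔ : Torus.laplacian (Torus.laplacian fun y => u y - w y) =
      fun y => Torus.laplacian (Torus.laplacian u) y - Torus.laplacian (Torus.laplacian w) y := by
    have e1 : Torus.laplacian (fun y => u y - w y) = Torus.laplacian u - Torus.laplacian w :=
      Torus.laplacian_sub hu hw
    rw [e1, Torus.laplacian_sub hu.laplacian hw.laplacian]
    rfl
  rw [hΔΔ] at h1
  have h2 := Torus.integral_norm_sub_sq_le_two_mul hu.laplacian.laplacian hw.laplacian.laplacian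
  linarith [mul_le_mul_of_nonneg_left hC zero_le_two, mul_le_mul_of_nonneg_left hD zero_le_two]

omit [DecidableEq d] in
/-- **A jointly smooth field on a compact window is bounded in `H⁴`**: for `u` jointly smooth on
`[a, b] × T^d`, `a < b`, there is `D` with `∫ ‖Δ²u(t)‖² ≤ D` for all `t ∈ [a, b]` (`Δ²u` is jointly
smooth, hence bounded on the compact `[a, b] × T^d`, and `vol(T^d) = 1`). [folklore] -/
theorem _root_.Literature.Analysis.FunctionSpaces.Torus.IsSmoothSpaceTimeOn.exists_integral_norm_laplacian_laplacian_sq_le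
    [DecidableEq d] {a b : ℝ} {u : ℝ → UnitAddTorus d → EuclideanSpace ℝ d}
    (hu : Torus.IsSmoothSpaceTimeOn (Icc a b) u) (hab : a < b) :
    ∃ D : ℝ, ∀ t ∈ Icc a b, ∫ x, ‖Torus.laplacian (Torus.laplacian (u t)) x‖ ^ 2 ≤ D := by
  have hU : UniqueDiffOn ℝ (Icc a b) := uniqueDiffOn_Icc hab
  have hΔΔ : Torus.IsSmoothSpaceTimeOn (Icc a b) (fun t => Torus.laplacian (Torus.laplacian (u t))) :=
    (hu.laplacian hU).laplacian hU
  obtain ⟨c, hc⟩ := hΔΔ.exists_norm_le_of_isCompact isCompact_Icc subset_rfl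
  refine ⟨c ^ 2, fun t ht => ?_⟩
  have hpt : ∀ x, ‖Torus.laplacian (Torus.laplacian (u t)) x‖ ^ 2 ≤ c ^ 2 := fun x =>
    pow_le_pow_left₀ (norm_nonneg _) (hc t ht x) 2
  calc ∫ x, ‖Torus.laplacian (Torus.laplacian (u t)) x‖ ^ 2 ≤ ∫ _ : UnitAddTorus d, c ^ 2 :=
        integral_mono (hΔΔ.isSmooth_slice ht).norm_sq.integrable (integrable_const _) hpt
    _ = c ^ 2 := by simp

end Literature.Analysis.FluidPDE

end
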